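import Literature.NumberTheory.Rogawski1990.UnitFundamentalLemmaSplitPlace
import Literature.NumberTheory.Automorphic.OrbitalIntegralCentralTransport
import Literature.NumberTheory.Automorphic.GLnLeviOrbitalDescentBochner
import HarnessLib

/-!
# [Rogawski1990 §4.9 Prop. 4.9.1 (b)] The unit fundamental lemma at a split place, BOCHNER ∕ `orbitalIntegral` form:
# `Φ^{G_v}(γ, 1_{K_v}) = c · Φ^{M}(p, 1_{K_M})` for `e γ = p ∈ M = GL₂ × GL₁ ≅ H_v`, `G`-regular, `c` VISIBLE
(Rogawski (1990), §4.9 Prop. 4.9.1 (b) p. 55; §4.13 Lemma 4.13.1 (a) p. 70 — `Φ^G(γ, f) = |D_{G∕M}(γ)|^{−1∕2} Φ^M(γ, f̄^P)` at the unit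
`f = 1_K` of the Hecke algebra, at a place `v` split in `E` where `G_v ≅ GL₃(E_w)`, `H_v ≅ GL₂ × GL₁` is a Levi subgroup)

Topic `NumberTheory/Rogawski1990`; namespace `Literature.NumberTheory.Automorphic` (§0, generic) and `Literature.NumberTheory.Rogawski1990` (§1).
THEOREMS ONLY (no definition, no instance, no named fact, no `sorry`). Cell `pub/hodgecm-mathlib`, programme P3a, letter **N7 (#103)** split-place
pay-down, row «D-N7s-E» (LEAD F0P3a-plan T7-5 (2)): the COMPLEX-VALUED ∕ `orbitalIntegral` reading of ★ `UnitFundamentalLemmaSplitPlace`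
(«D-N7s» (n7-i), `[0, ∞]`-valued) — the currency of the tree's named orbital integral ★ `orbitalIntegral γ f m` and of the transfer relations
★ `IsDeltaTransferRel` ∕ `IsLocalUnitTransfer` — over the Bochner descent ★ `GLnLeviOrbitalDescentBochner`
(`exists_integral_descConj_eq_smul_integral_levi`, integrability of the `G`-side orbital integrand a HYPOTHESIS as there).

* §0 `integral_prod_indicator_glInt_conj_levi_mul` — the `ℂ`-valued twin of ★ `lintegral_prod_indicator_glInt_conj_levi_mul`
  (`GLnIntegralLeviUnipotent`): «the constant term of `1_K` is `κ(K) μ_U(U(𝒪)) · 1_{K_M}`» for `m ∈ M_c`.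
* §1 **`exists_orbitalIntegral_indicator_eq_smul_levi_of_split`** — for the GL-side data of ★ (n7-i) (closed `T′ ≤ M_{c′}`, Haar-type `ρ′` on `T′`,
  Haar `ν′` with `ν′(GL_N(𝒪_w)) = 1`, non-zero invariant Radon `μ_{G∕M}`, `μ_{M∕T′}` (s-finite), Haar `κ`, `μ_U` (s-finite)) there is ONE
  `C ∈ (0, ∞)` — the constant of ★ `exists_integral_descConj_eq_smul_integral_levi` for `(ν′∕ρ′, μ_{G∕M}, μ_{M∕T′}, κ, μ_U)` — such that for EVERY
  `γ ∈ U(J)(F_v)` with `e γ = p ∈ M_{c′}` (`e = localSplitEquiv`, ★ «D-S1d»), `T′ = e(C(γ))` centralising `p`, `det(1 − K_p) ≠ 0`, every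
  `vol K_v = 1` Haar `ν`, every `ρ` on `C(γ)` with `(e|)_* ρ = ρ′`, PROVIDED the `G`-side orbital integrand of `1_{GL_N(𝒪_w)}` is
  `ν′∕ρ′`-integrable (closed orbit: ★ `integrable_descConj_of_isClosed`):
  `orbitalIntegral γ 1_{U(J)(𝒪_v)} (ν∕ρ) = ((C ‖det(1−K_p)‖_w⁻¹ ‖det K_p‖_w).toReal · (κ(K) μ_U(U_{c′}(𝒪_w))).toReal) • ∫_{M ⧸ T′} 1_{K_M}(m p m⁻¹) dμ_{M∕T′}`
  — «`Φ^{G_v}(γ, 1_{K_v}) = c · |D_{G∕M}(p)|^{−1∕2} δ_P(p)^{1∕2} · Φ^{M}(p, 1_{K_M})`», `c` VISIBLE.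

`c` is NOT pinned here (for the canonical normalisations `C = 1`: «D-S1c-canonical» ∕ «D-S1c-one», F0P3a-p03 ∕ p08); the constants of ★ (n7-i)
(`[0,∞]`, from ★ D-S1c) and of §1 (from ★ p838326) are two existentials and are not identified here. `‖det K_p‖ = 1` on `P ∩ K` is ★
`normAbs_det_boxAd_eq_one_of_mem_glInt`; the `|D_{G∕M}|^{1∕2}` presentation of ★ D-S2 is ★ `finWeylRatio_eq_boxAd_of_split`; the junction with
the letter's `IsLocalUnitTransfer` on the frame `H_v = U(Φ₂)_v × U(Φ₁)_v` is floor 2 (★ `LocalTransferSplitPlaceClasses`, «D-N6s» B3).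
`G`-regular classes only; nothing at non-split places. GL-side `LocallyCompactSpace`∕`SecondCountableTopology` are BINDERS.
HC_CM is proved only modulo the printed citations until rung 0 closes; this file discharges none of them.

## References
* J. D. Rogawski, *Automorphic Representations of Unitary Groups in Three Variables* (1990), §4.9 Prop. 4.9.1 (b) p. 55; §4.13 Lemma
  4.13.1 (a), proof p. 70 [Rogawski1990].
* D. Blasius, J. D. Rogawski, *Fundamental lemmas for `U(3)` and related groups* (1992), Thm. 1 [BlasiusRogawski1992].
* C. P. Mok, *Endoscopic classification of representations of quasi-split unitary groups* (2015), §1 p. 5 [Mok2014].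
-/

set_option autoImplicit false

noncomputable section

open MeasureTheory Measure Set Filter Topology NumberField IsDedekindDomain Literature.MeasureTheory.Group
open scoped ENNReal NNReal Matrix MatrixGroups

namespace Literature.NumberTheory.Automorphic

open Literature.NumberTheory.GaloisRepresentations.IsNonarchimedeanLocalField

/-! ## §0 The constant term of `1_K`, complex-valued -/

section LeviBochner

variable {F : Type*} [Field F] [ValuativeRel F] [TopologicalSpace F] [IsNonarchimedeanLocalField F] {n : ℕ} {α : Type*}
  [LinearOrder α] [Fintype α] {c : Fin n → α} [MeasurableSpace (GL (Fin n) F)] [BorelSpace (GL (Fin n) F)]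

/-- **The constant term of `1_K` is `κ(K) μ_U(U(𝒪)) · 1_{K_M}`, complex-valued**: for `m ∈ M_c`,
`∫_{K × U_c} 1_K(k (m u) k⁻¹) d(κ ⊗ μ_U) = (κ(K) μ_U(U_c ∩ K)) · 1_K(m)` in `ℂ` (the Bochner twin of ★
`lintegral_prod_indicator_glInt_conj_levi_mul`; the inner integral of ★ `exists_integral_descConj_eq_smul_integral_levi` at `φ = 1_K`).
[cite: Rogawski1990, §4.13, proof of Lemma 4.13.1, p. 70] [cite: Rogawski1990, §4.9 Prop. 4.9.1 (b) p. 55] -/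
theorem integral_prod_indicator_glInt_conj_levi_mul (κ : Measure ↥(glInt n F)) (μU : Measure ↥(unipotentRadicalGL F c))
    [SFinite μU] {m : GL (Fin n) F} (hm : m ∈ standardLeviGL F c) :
    ∫ q : ↥(glInt n F) × ↥(unipotentRadicalGL F c),
        (glInt n F : Set (GL (Fin n) F)).indicator (fun _ => (1 : ℂ))
          ((q.1 : GL (Fin n) F) * (m * (q.2 : GL (Fin n) F)) * (q.1 : GL (Fin n) F)⁻¹) ∂(κ.prod μU) =
      ((κ univ * μU {u | (u : GL (Fin n) F) ∈ glInt n F}).toReal : ℂ) *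
        (glInt n F : Set (GL (Fin n) F)).indicator (fun _ => (1 : ℂ)) m := by
  haveI : T2Space F := (isLocalField F).toT2Space
  haveI : SecondCountableTopology F := secondCountableTopology_localField F
  haveI : SecondCountableTopology (Matrix (Fin n) (Fin n) F) := inferInstanceAs (SecondCountableTopology (Fin n → Fin n → F))
  haveI : SecondCountableTopology (Matrix (Fin n) (Fin n) F)ᵐᵒᵖ := MulOpposite.opHomeomorph.symm.secondCountableTopology
  haveI : SecondCountableTopology (GL (Fin n) F) := Units.isEmbedding_embedProduct.secondCountableTopology
  haveI : BorelSpace ↥(unipotentRadicalGL F c) := Subtype.borelSpace _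
  haveI : BorelSpace ↥(glInt n F) := Subtype.borelSpace _
  have hcont : Continuous fun q : ↥(glInt n F) × ↥(unipotentRadicalGL F c) =>
      (q.1 : GL (Fin n) F) * (m * (q.2 : GL (Fin n) F)) * (q.1 : GL (Fin n) F)⁻¹ :=
    ((continuous_subtype_val.comp continuous_fst).mul
      (continuous_const.mul (continuous_subtype_val.comp continuous_snd))).mul
      (continuous_subtype_val.comp continuous_fst).inv
  have hS : MeasurableSet {q : ↥(glInt n F) × ↥(unipotentRadicalGL F c) |
      (q.1 : GL (Fin n) F) * (m * (q.2 : GL (Fin n) F)) * (q.1 : GL (Fin n) F)⁻¹ ∈ glInt n F} :=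
    ((isOpen_glInt n F).preimage hcont).measurableSet
  have h1 : (fun q : ↥(glInt n F) × ↥(unipotentRadicalGL F c) =>
      (glInt n F : Set (GL (Fin n) F)).indicator (fun _ => (1 : ℂ))
        ((q.1 : GL (Fin n) F) * (m * (q.2 : GL (Fin n) F)) * (q.1 : GL (Fin n) F)⁻¹)) =
      {q : ↥(glInt n F) × ↥(unipotentRadicalGL F c) |
        (q.1 : GL (Fin n) F) * (m * (q.2 : GL (Fin n) F)) * (q.1 : GL (Fin n) F)⁻¹ ∈ glInt n F}.indicator fun _ => (1 : ℂ) := by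
    funext q; rfl
  have h2 : (κ.prod μU) {q : ↥(glInt n F) × ↥(unipotentRadicalGL F c) |
      (q.1 : GL (Fin n) F) * (m * (q.2 : GL (Fin n) F)) * (q.1 : GL (Fin n) F)⁻¹ ∈ glInt n F} =
      κ univ * μU {u | (u : GL (Fin n) F) ∈ glInt n F} * (glInt n F : Set (GL (Fin n) F)).indicator 1 m := by
    rw [← lintegral_indicator_one hS, ← lintegral_prod_indicator_glInt_conj_levi_mul κ μU hm]
    rfl
  rw [h1, integral_indicator_const _ hS, measureReal_def, h2, Complex.real_smul, mul_one]
  by_cases hmK : m ∈ glInt n F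
  · rw [Set.indicator_of_mem (show m ∈ (glInt n F : Set (GL (Fin n) F)) from hmK),
      Set.indicator_of_mem (show m ∈ (glInt n F : Set (GL (Fin n) F)) from hmK), Pi.one_apply, mul_one, mul_one]
  · rw [Set.indicator_of_notMem (show m ∉ (glInt n F : Set (GL (Fin n) F)) from hmK),
      Set.indicator_of_notMem (show m ∉ (glInt n F : Set (GL (Fin n) F)) from hmK), mul_zero, mul_zero,
      ENNReal.toReal_zero, Complex.ofReal_zero]

end LeviBochner

end Literature.NumberTheory.Automorphic

namespace Literature.NumberTheory.Rogawski1990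

open Literature.NumberTheory.Automorphic Literature.NumberTheory.Automorphic.UnitaryGroup
open Literature.NumberTheory.GaloisRepresentations.IsNonarchimedeanLocalField

/-! ## §1 (n7-i) in the `orbitalIntegral` ∕ `ℂ` currency -/

section Split

variable {F E : Type} [Field F] [NumberField F] [Field E] [NumberField E] [Algebra F E]
  [Algebra.IsQuadraticExtension F E]
  (c : E ≃ₐ[F] E) (N : ℕ) (J : Matrix (Fin N) (Fin N) E) {v : HeightOneSpectrum (𝓞 F)}
  (hc : c ≠ 1) (hJ : (J.map c)ᵀ = J) (w : PlacesOver E v) (hw : c • w.1 ≠ w.1)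
  (hJw : IsUnit (placeForm J w.1)) {c' : Fin N → Bool}
  [MeasurableSpace (w.1.adicCompletion E)] [BorelSpace (w.1.adicCompletion E)]
  [MeasurableSpace («local» E c N J v)] [BorelSpace («local» E c N J v)]
  [MeasurableSpace (GL (Fin N) (w.1.adicCompletion E))] [BorelSpace (GL (Fin N) (w.1.adicCompletion E))]
  [LocallyCompactSpace (GL (Fin N) (w.1.adicCompletion E))] [SecondCountableTopology (GL (Fin N) (w.1.adicCompletion E))]
  (T' : Subgroup (GL (Fin N) (w.1.adicCompletion E)))
  (hT' : IsClosed (T' : Set (GL (Fin N) (w.1.adicCompletion E)))) (hT'M : T' ≤ standardLeviGL (w.1.adicCompletion E) c')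
  [MeasurableSpace (GL (Fin N) (w.1.adicCompletion E) ⧸ T')] [BorelSpace (GL (Fin N) (w.1.adicCompletion E) ⧸ T')]
  [MeasurableSpace (GL (Fin N) (w.1.adicCompletion E) ⧸ standardLeviGL (w.1.adicCompletion E) c')]
  [BorelSpace (GL (Fin N) (w.1.adicCompletion E) ⧸ standardLeviGL (w.1.adicCompletion E) c')]
  [MeasurableSpace (↥(standardLeviGL (w.1.adicCompletion E) c') ⧸ T'.subgroupOf (standardLeviGL (w.1.adicCompletion E) c'))]
  [BorelSpace (↥(standardLeviGL (w.1.adicCompletion E) c') ⧸ T'.subgroupOf (standardLeviGL (w.1.adicCompletion E) c'))]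
  (ρ' : Measure ↥T') [ρ'.IsMulLeftInvariant] [IsFiniteMeasureOnCompacts ρ'] [ρ'.IsOpenPosMeasure] [ρ'.IsInvInvariant]
  [SFinite ρ']
  (ν' : Measure (GL (Fin N) (w.1.adicCompletion E))) [IsHaarMeasure ν'] [ν'.IsMulRightInvariant]
  (μGM : Measure (GL (Fin N) (w.1.adicCompletion E) ⧸ standardLeviGL (w.1.adicCompletion E) c'))
  [SMulInvariantMeasure (GL (Fin N) (w.1.adicCompletion E))
    (GL (Fin N) (w.1.adicCompletion E) ⧸ standardLeviGL (w.1.adicCompletion E) c') μGM] [IsFiniteMeasureOnCompacts μGM]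
  (μMT : Measure (↥(standardLeviGL (w.1.adicCompletion E) c') ⧸ T'.subgroupOf (standardLeviGL (w.1.adicCompletion E) c')))
  [SMulInvariantMeasure ↥(standardLeviGL (w.1.adicCompletion E) c')
    (↥(standardLeviGL (w.1.adicCompletion E) c') ⧸ T'.subgroupOf (standardLeviGL (w.1.adicCompletion E) c')) μMT]
  [IsFiniteMeasureOnCompacts μMT] [SFinite μMT]
  (κ : Measure ↥(glInt N (w.1.adicCompletion E))) [IsHaarMeasure κ]
  (μU : Measure ↥(unipotentRadicalGL (w.1.adicCompletion E) c')) [IsHaarMeasure μU] [SFinite μU]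

include hT' hT'M in
/-- **(n7-i), `orbitalIntegral` form — the unit orbital integral of `U(J)(F_v)` at a split place, `G`-regular `γ` with `e γ = p ∈ M_{c′}`, IS a
visible constant times the unit orbital integral of `M_{c′}`**: with the GL-side data as in ★ `exists_lintegral_orbital_indicator_eq_mul_levi_of_split`
(`μ_{M∕T′}`, `μ_U` s-finite) there is ONE `C ∈ (0, ∞)` — the constant of ★ `exists_integral_descConj_eq_smul_integral_levi` for
`(ν′∕ρ′, μ_{G∕M}, μ_{M∕T′}, κ, μ_U)` — such that for every `γ`, `p`, `ν` (`ν(K_v) = 1`), `ρ` (`(e|)_* ρ = ρ′`), provided the `G`-side orbital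
integrand of `1_{GL_N(𝒪_w)}` is `ν′∕ρ′`-integrable:
`orbitalIntegral γ 1_{U(J)(𝒪_v)} (ν∕ρ) = ((C ‖det(1−K_p)‖⁻¹ ‖det K_p‖).toReal · (κ(K) μ_U(U_{c′}(𝒪_w))).toReal) • ∫_{M ⧸ T′} 1_{K_M}(m p m⁻¹) dμ_{M∕T′}`
(★ `integral_descConj_quotientMeasure_eq_of_mulEquiv` + ★ D-S1d + ★ p838326 + §0). «`Φ^{G_v}(γ, 1_{K_v}) = c · |D_{G∕M}(p)|^{−1∕2} δ_P(p)^{1∕2} Φ^M(p, 1_{K_M})`»,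
`c` VISIBLE, not pinned. [cite: Rogawski1990, §4.9 Prop. 4.9.1 (b) p. 55] [cite: Rogawski1990, §4.13, Lemma 4.13.1 (a), proof p. 70]
[cite: Mok2014, §1 Notation p. 5] -/
theorem exists_orbitalIntegral_indicator_eq_smul_levi_of_split (hc' : Monotone c')
    (hJi : hJw.unit ∈ glInt N (w.1.adicCompletion E)) (hν' : ν' (glInt N (w.1.adicCompletion E)) = 1) (hGM : μGM ≠ 0)
    (hMT : μMT ≠ 0) :
    ∃ C : ℝ≥0∞, C ≠ 0 ∧ C ≠ ∞ ∧ ∀ (γ : «local» E c N J v) (p : standardParabolicGL (w.1.adicCompletion E) c')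
      (hpM : (p : GL (Fin N) (w.1.adicCompletion E)) ∈ standardLeviGL (w.1.adicCompletion E) c')
      (_ : localSplitEquiv c J hc hJ w hw hJw γ = (p : GL (Fin N) (w.1.adicCompletion E)))
      (hpT : ∀ t ∈ T', t * (p : GL (Fin N) (w.1.adicCompletion E)) = (p : GL (Fin N) (w.1.adicCompletion E)) * t)
      (hTγ : ∀ g : «local» E c N J v, (localSplitEquiv c J hc hJ w hw hJw).toMulEquiv g ∈ T' ↔
        g ∈ Subgroup.centralizer ({γ} : Set («local» E c N J v)))
      (_ : (1 - Matrix.of fun q q' : {i : Fin N // c' i = false} × {j : Fin N // c' j = true} =>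
          ((p : GL (Fin N) (w.1.adicCompletion E)) : Matrix (Fin N) (Fin N) (w.1.adicCompletion E)) q.1 q'.1 *
            (((p⁻¹ : standardParabolicGL (w.1.adicCompletion E) c') : GL (Fin N) (w.1.adicCompletion E)) :
              Matrix (Fin N) (Fin N) (w.1.adicCompletion E)) q'.2 q.2).det ≠ 0)
      [MeasurableSpace (↥(«local» E c N J v) ⧸ Subgroup.centralizer ({γ} : Set («local» E c N J v)))]
      [BorelSpace (↥(«local» E c N J v) ⧸ Subgroup.centralizer ({γ} : Set («local» E c N J v)))]
      (hC : IsClosed ((Subgroup.centralizer ({γ} : Set («local» E c N J v)) : Subgroup («local» E c N J v)) :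
        Set («local» E c N J v)))
      (ρ : Measure (Subgroup.centralizer ({γ} : Set («local» E c N J v)))) [ρ.IsMulLeftInvariant]
      [IsFiniteMeasureOnCompacts ρ] [ρ.IsOpenPosMeasure] [ρ.IsInvInvariant] [SFinite ρ]
      (_ : ρ' = Measure.map (subgroupCongrHomeomorph (localSplitEquiv c J hc hJ w hw hJw).toMulEquiv _ T' hTγ
        (localSplitEquiv c J hc hJ w hw hJw).continuous (localSplitEquiv c J hc hJ w hw hJw).symm.continuous) ρ)
      (ν : Measure («local» E c N J v)) [IsHaarMeasure ν] [ν.IsMulRightInvariant]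
      (_ : ν (localIntegralLevel c N J v) = 1)
      (_ : Integrable (descConj (p : GL (Fin N) (w.1.adicCompletion E)) T' hpT
        ((glInt N (w.1.adicCompletion E) : Set (GL (Fin N) (w.1.adicCompletion E))).indicator fun _ => (1 : ℂ)))
        (quotientMeasure T' ρ' hT' ν')),
      orbitalIntegral γ ((localIntegralLevel c N J v : Set («local» E c N J v)).indicator fun _ => (1 : ℂ))
          (quotientMeasure (Subgroup.centralizer ({γ} : Set («local» E c N J v))) ρ hC ν) =
        ((C * ((normAbs (w.1.adicCompletion E) ((1 - Matrix.of
              fun q q' : {i : Fin N // c' i = false} × {j : Fin N // c' j = true} =>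
                ((p : GL (Fin N) (w.1.adicCompletion E)) : Matrix (Fin N) (Fin N) (w.1.adicCompletion E)) q.1 q'.1 *
                  (((p⁻¹ : standardParabolicGL (w.1.adicCompletion E) c') : GL (Fin N) (w.1.adicCompletion E)) :
                    Matrix (Fin N) (Fin N) (w.1.adicCompletion E)) q'.2 q.2).det)⁻¹ *
            normAbs (w.1.adicCompletion E) (Matrix.of
              fun q q' : {i : Fin N // c' i = false} × {j : Fin N // c' j = true} =>
                ((p : GL (Fin N) (w.1.adicCompletion E)) : Matrix (Fin N) (Fin N) (w.1.adicCompletion E)) q.1 q'.1 *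
                  (((p⁻¹ : standardParabolicGL (w.1.adicCompletion E) c') : GL (Fin N) (w.1.adicCompletion E)) :
                    Matrix (Fin N) (Fin N) (w.1.adicCompletion E)) q'.2 q.2).det : ℝ≥0) : ℝ≥0∞)).toReal *
          (κ univ * μU {u | (u : GL (Fin N) (w.1.adicCompletion E)) ∈ glInt N (w.1.adicCompletion E)}).toReal : ℝ) •
          ∫ z, descConj (⟨(p : GL (Fin N) (w.1.adicCompletion E)), hpM⟩ : ↥(standardLeviGL (w.1.adicCompletion E) c'))
              (T'.subgroupOf (standardLeviGL (w.1.adicCompletion E) c'))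
              (fun t ht => Subtype.ext (hpT (t : GL (Fin N) (w.1.adicCompletion E)) ht))
              (fun m : ↥(standardLeviGL (w.1.adicCompletion E) c') =>
                (glInt N (w.1.adicCompletion E) : Set (GL (Fin N) (w.1.adicCompletion E))).indicator (fun _ => (1 : ℂ))
                  (m : GL (Fin N) (w.1.adicCompletion E)))
              z ∂μMT := by
  haveI : IsClosed ((T' : Subgroup (GL (Fin N) (w.1.adicCompletion E))) : Set (GL (Fin N) (w.1.adicCompletion E))) := hT'
  haveI : IsClosed ((standardLeviGL (w.1.adicCompletion E) c' : Subgroup (GL (Fin N) (w.1.adicCompletion E))) :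
      Set (GL (Fin N) (w.1.adicCompletion E))) := isClosed_standardLeviGL (R := w.1.adicCompletion E) c'
  obtain ⟨C, hC0, hCt, h⟩ := exists_integral_descConj_eq_smul_integral_levi (w.1.adicCompletion E) hc'
    (M := standardLeviGL (w.1.adicCompletion E) c') rfl hT' hT'M (quotientMeasure T' ρ' hT' ν')
    (quotientMeasure_ne_zero T' ρ' hT' ν') μGM hGM μMT hMT κ μU
  refine ⟨C, hC0, hCt, ?_⟩
  intro γ p hpM hγ hpT hTγ hp _ _ hCl ρ _ _ _ _ _ hρ ν _ _ hν hint
  have hν'e : ν' = ν.map (localSplitEquiv c J hc hJ w hw hJw) :=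
    (map_localSplitEquiv_eq c N J hc hJ w hw hJw hJi ν ν' hν hν').symm
  have hclo : IsClopen (glInt N (w.1.adicCompletion E) : Set (GL (Fin N) (w.1.adicCompletion E))) :=
    ⟨(isCompact_glInt N (w.1.adicCompletion E)).isClosed, isOpen_glInt N (w.1.adicCompletion E)⟩
  -- Step 1: `U(J)(F_v)`-side = GL-side on the FIXED quotient `GL_N ⧸ T′`, `1_{K_v} = 1_{GL_N(𝒪_w)} ∘ e`
  have h1 := integral_descConj_quotientMeasure_eq_of_mulEquiv (localSplitEquiv c J hc hJ w hw hJw).toMulEquiv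
    (localSplitEquiv c J hc hJ w hw hJw).continuous (localSplitEquiv c J hc hJ w hw hJw).symm.continuous
    (Subgroup.centralizer ({γ} : Set («local» E c N J v))) T' hTγ (hH := hCl) (hH' := hT') ρ ρ' ν ν' hρ hν'e hγ
    (fun _ hg => Subgroup.mem_centralizer_singleton_iff.1 hg) hpT
    ((glInt N (w.1.adicCompletion E) : Set (GL (Fin N) (w.1.adicCompletion E))).indicator fun _ => (1 : ℂ))
  have hind : ((glInt N (w.1.adicCompletion E) : Set (GL (Fin N) (w.1.adicCompletion E))).indicator fun _ => (1 : ℂ)) ∘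
      ⇑(localSplitEquiv c J hc hJ w hw hJw).toMulEquiv =
        (localIntegralLevel c N J v : Set («local» E c N J v)).indicator fun _ => (1 : ℂ) :=
    indicator_glInt_comp_localSplitEquiv c N J hc hJ w hw hJw hJi (fun _ => (1 : ℂ))
  rw [hind] at h1
  rw [orbitalIntegral_eq_integral_descConj, ← h1]
  -- Step 2: the GL-side Bochner descent ★ p838326 at `φ = 1_{GL_N(𝒪_w)}`
  obtain ⟨-, h2⟩ := h p hpM hpT hp _ (hclo.continuous_indicator (continuous_const (y := (1 : ℂ)))) hint
  rw [h2]
  -- Step 3: the constant term of `1_K` (§0), and the constant pulled out of the `M`-side orbital integral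
  have hinner : (fun m : ↥(standardLeviGL (w.1.adicCompletion E) c') =>
      ∫ q : ↥(glInt N (w.1.adicCompletion E)) × ↥(unipotentRadicalGL (w.1.adicCompletion E) c'),
        (glInt N (w.1.adicCompletion E) : Set (GL (Fin N) (w.1.adicCompletion E))).indicator (fun _ => (1 : ℂ))
          ((q.1 : GL (Fin N) (w.1.adicCompletion E)) * ((m : GL (Fin N) (w.1.adicCompletion E)) *
            (q.2 : GL (Fin N) (w.1.adicCompletion E))) * (q.1 : GL (Fin N) (w.1.adicCompletion E))⁻¹) ∂(κ.prod μU)) =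
      (fun x : ℂ => ((κ univ * μU {u | (u : GL (Fin N) (w.1.adicCompletion E)) ∈ glInt N (w.1.adicCompletion E)}).toReal : ℂ) * x) ∘
        (fun m : ↥(standardLeviGL (w.1.adicCompletion E) c') =>
          (glInt N (w.1.adicCompletion E) : Set (GL (Fin N) (w.1.adicCompletion E))).indicator (fun _ => (1 : ℂ))
            (m : GL (Fin N) (w.1.adicCompletion E))) :=
    funext fun m => Automorphic.integral_prod_indicator_glInt_conj_levi_mul κ μU m.2
  rw [hinner, descConj_comp]
  simp only [Function.comp_def]
  rw [integral_const_mul, Complex.real_smul, Complex.real_smul, Complex.ofReal_mul, mul_assoc]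

end Split

end Literature.NumberTheory.Rogawski1990

end
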